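import Mathlib
import Summits.KontsevichZagierPeriods.KontsevichZagierPeriods.Theorems.InverseLandauTateFamilyKernelStubGvDivision

/-!
# Crux `TateFamilyKernel` (stmt-KontsevichZagierPeriods-9130), line `Sketch`:
# stub `stub_gwRationalPrimitive`

Step GW3a of the graph-pencil class with a GENERAL polynomial slope, `Q = 1 − ϖ·(u(z₂) + v(z₂)z₁)`
(`u, v ∈ ℚ[s]`, `v ≠ 0` on `[0, 1]`, `P ∈ ℚ[z₁, z₂]`), of the lead's skeleton of the crux
`Summit.KontsevichZagierPeriods.KontsevichZagierPeriods.Theses.InverseLandau.TateFamilyKernel`: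
**the single-branch integrand has a RATIONAL primitive** — no logarithms, no partial fractions.
Write `V, W` for the real polynomial functions of `v, u + v` and
`f(y, σ) = P((y − u(σ))/V(σ), σ)/V(σ) = Σ_{l ≤ D} yˡ·φ_l(σ)`, `φ_l = Q_l/V^{c+1}`, `Q_l ∈ ℝ[σ]`
(`exists_decomp`). Hypotheses: `W' > 0` on `(s₁, 1)` and `∫_{(s,1)} f(W(s), σ) dσ = 0` for
`s ∈ (s₁, 1)`; conclusion: `f(y, ·)` has a primitive `Rn(y, ·)/V^k` on `[0, 1]`, `Rn ∈ ℝ[y, σ]`.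

1. *FTC.* `I_l(s) = ∫_{(s,1)} φ_l` has derivative `−φ_l` on `(s₁, 1)`, and `Σ_l W(s)ˡ I_l(s) = 0`.
2. *Triangular elimination* (`elim`, induction on `D`). Call a function RATIONAL if on `(s₁, 1)`
   it is a quotient of real polynomials without poles there; RATIONAL is stable under sums,
   products with polynomials, division by `W'` and — by uniqueness of derivatives — under `d/ds`
   (`rat_deriv`). Differentiating `Σ_{l ≤ D+1} Wˡ I_l` and dividing by `W'` shows that
   `Σ_{l ≤ D} Wˡ·(l+1)I_{l+1}` is RATIONAL, whence every `I_l` is.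
3. *Cancellation* (`exists_mul_eq_mul_pow`): if `p/q` (coprime) has derivative `M/B`, every prime
   factor `π` of `q` divides `B` (`q ∣ B·p·q'` and `v_π(q') = v_π(q) − 1`), so `p/q = g/Bⁿ`. With
   `B = V^{c+1}` the spurious powers of `W'` leave the denominators, and `(g/Bᵏ)' = −φ_l`, valid
   on `(s₁, 1)`, is a polynomial identity, so it holds wherever `V ≠ 0` (`exists_primitive`).
4. `Rn = −Σ_l (X 0)ˡ·g_l(X 1)` over the common denominator `V^{(c+1)k}`.

References: Kontsevich–Zagier 2001, §1.2. Mathlib and the landed file `…StubGvDivision`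
(`GvDivision.hasDerivAt_of_integral_eq`) only; no named fact, no new definition (RATIONAL is an
`∃` in each helper). Helpers live in the sub-namespace `GwRationalPrimitive`.
-/

noncomputable section

open MeasureTheory Set MvPolynomial
open Literature.NumberTheory.Transcendental

namespace Summit.KontsevichZagierPeriods.InverseLandau.TateFamilyKernel.Descent

namespace GwRationalPrimitive

/-- Quotient rule for `p/q`, `p, q ∈ ℝ[X]`, at a point where `q ≠ 0`. [folklore] -/
theorem hasDerivAt_div (p q : Polynomial ℝ) {s : ℝ} (hq : q.eval s ≠ 0) :
    HasDerivAt (fun t => p.eval t / q.eval t)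
      ((p.derivative * q - p * q.derivative).eval s / (q ^ 2).eval s) s := by
  simpa [Polynomial.eval_mul, Polynomial.eval_sub, Polynomial.eval_pow] using
    (p.hasDerivAt s).fun_div (q.hasDerivAt s) hq

/-- If `(p/q)' = M/B` on an infinite set where `q, B ≠ 0`, then `B·(p'q − pq') = M·q²` in `ℝ[X]`
(uniqueness of derivatives and `Polynomial.eq_of_infinite_eval_eq`). [folklore] -/
theorem poly_eq_of_hasDerivAt {S : Set ℝ} (hS : S.Infinite) (p q M B : Polynomial ℝ)
    (hq : ∀ s ∈ S, q.eval s ≠ 0) (hB : ∀ s ∈ S, B.eval s ≠ 0)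
    (h : ∀ s ∈ S, HasDerivAt (fun t => p.eval t / q.eval t) (M.eval s / B.eval s) s) :
    B * (p.derivative * q - p * q.derivative) = M * q ^ 2 := by
  refine Polynomial.eq_of_infinite_eval_eq _ _ (hS.mono fun s hs => ?_)
  have h1 := (hasDerivAt_div p q (hq s hs)).unique (h s hs)
  rw [div_eq_div_iff (by simpa using pow_ne_zero 2 (hq s hs)) (hB s hs)] at h1
  simp only [Set.mem_setOf_eq, Polynomial.eval_mul]
  linear_combination h1

/-- **Valuations.** If `q ∣ B·p·q'` in `ℝ[X]` (`q ≠ 0`), every prime factor `π ∤ p` of `q` divides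
`B`: if `q = π^{m+1}·r`, `π ∤ r`, then `q' = π^m·((m+1)π'r + πr')` and `π ∤ (m+1)π'r`. [folklore] -/
theorem prime_dvd {p q B π : Polynomial ℝ} (hq : q ≠ 0) (h : q ∣ B * p * q.derivative)
    (hπ : Prime π) (hπq : π ∣ q) (hπp : ¬π ∣ p) : π ∣ B := by
  obtain ⟨m, r, hr, rfl⟩ := WfDvdMonoid.max_power_factor hq hπ.irreducible
  obtain ⟨m, rfl⟩ : ∃ m' : ℕ, m = m' + 1 :=
    Nat.exists_eq_succ_of_ne_zero (by rintro rfl; exact hr (by simpa using hπq))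
  have h1 : π ^ m * (π * r) ∣ π ^ m * (B * p *
      (Polynomial.C ((m : ℝ) + 1) * π.derivative * r + π * r.derivative)) := by
    convert h using 1
    · ring
    · rw [Polynomial.derivative_mul, Polynomial.derivative_pow_succ]
      ring
  rw [mul_dvd_mul_iff_left (pow_ne_zero m hπ.ne_zero)] at h1
  rcases hπ.dvd_or_dvd ((dvd_mul_right π r).trans h1) with h2 | h2
  · exact (hπ.dvd_or_dvd h2).elim id fun h3 => absurd h3 hπp
  rw [dvd_add_left (dvd_mul_right π _)] at h2
  rcases hπ.dvd_or_dvd h2 with h3 | h3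
  · rcases hπ.dvd_or_dvd h3 with h4 | h4
    · exact absurd (isUnit_of_dvd_unit h4 (Polynomial.isUnit_C.2
        (isUnit_iff_ne_zero.2 (Nat.cast_add_one_ne_zero m)))) hπ.not_unit
    · refine absurd h4 (Polynomial.not_dvd_of_degree_lt (Polynomial.derivative_ne_zero.2 ?_)
        (Polynomial.degree_derivative_lt hπ.ne_zero))
      exact (Polynomial.natDegree_pos_iff_degree_pos.2 (Polynomial.degree_pos_of_irreducible
        hπ.irreducible)).ne'
  · exact absurd h3 hr

/-- If every prime factor of `q ≠ 0` divides `B`, then `q` divides a power of `B`. [folklore] -/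
theorem dvd_pow_of_forall_prime (B : Polynomial ℝ) {q : Polynomial ℝ} (hq : q ≠ 0)
    (h : ∀ π : Polynomial ℝ, Prime π → π ∣ q → π ∣ B) : ∃ n : ℕ, q ∣ B ^ n := by
  induction q using UniqueFactorizationMonoid.induction_on_prime with
  | h₁ => exact absurd rfl hq
  | h₂ x hx => exact ⟨0, hx.dvd⟩
  | h₃ a π ha hπ ih =>
    obtain ⟨n, hn⟩ := ih ha fun ρ hρ hρa => h ρ hρ (hρa.mul_left π)
    exact ⟨n + 1, by rw [pow_succ']; exact mul_dvd_mul (h π hπ (dvd_mul_right π a)) hn⟩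

/-- **Cancellation lemma.** If `B·(p'q − pq') = M·q²` in `ℝ[X]` (`q ≠ 0`: the derivative of `p/q`
has denominator `B`), then `p/q = g/Bⁿ`: after cancelling `gcd(p, q)` one has `q ∣ B·p·q'`, so every
prime factor of `q` divides `B` (`prime_dvd`). [folklore] -/
theorem exists_mul_eq_mul_pow {p q M B : Polynomial ℝ} (hq : q ≠ 0)
    (h : B * (p.derivative * q - p * q.derivative) = M * q ^ 2) :
    ∃ (g : Polynomial ℝ) (n : ℕ), g * q = p * B ^ n := by
  obtain ⟨p₁, q₁, hp, hq', hu⟩ := extract_gcd p q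
  generalize gcd p q = γ at hp hq'
  subst hp hq'
  obtain ⟨hγ, hq₁⟩ := mul_ne_zero_iff.1 hq
  have h1 : B * (p₁.derivative * q₁ - p₁ * q₁.derivative) = M * q₁ ^ 2 := by
    refine mul_left_cancel₀ (pow_ne_zero 2 hγ) ?_
    rw [Polynomial.derivative_mul, Polynomial.derivative_mul] at h
    linear_combination h
  have h2 : q₁ ∣ B * p₁ * q₁.derivative :=
    ⟨B * p₁.derivative - M * q₁, by linear_combination -h1⟩
  obtain ⟨n, c, hc⟩ : ∃ n : ℕ, q₁ ∣ B ^ n :=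
    dvd_pow_of_forall_prime B hq₁ fun π hπ hπq => prime_dvd hq₁ h2 hπ hπq fun hπp =>
      hπ.not_unit (isUnit_of_dvd_unit (dvd_gcd hπp hπq) hu)
  exact ⟨p₁ * c, n, by rw [hc]; ring⟩

/-- **Rational primitives extend.** If `I` is rational on `(a, b)` with derivative `M/B` there
(`B ≠ 0` on `(a, b)`), then for all large `k` some `g ∈ ℝ[X]` has `(g/Bᵏ)' = M/B` at EVERY point
where `B ≠ 0`: `I = g/Bᵏ` on `(a, b)` (cancellation), and `(g/Bᵏ)' = M/B` is a polynomial identity.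
[folklore] -/
theorem exists_primitive {a b : ℝ} (hab : a < b) (M B : Polynomial ℝ) (I : ℝ → ℝ)
    (hB : ∀ s ∈ Ioo a b, B.eval s ≠ 0)
    (hI : ∃ p q : Polynomial ℝ, (∀ s ∈ Ioo a b, q.eval s ≠ 0) ∧
      (Ioo a b).EqOn I fun s => p.eval s / q.eval s)
    (hd : ∀ s ∈ Ioo a b, HasDerivAt I (M.eval s / B.eval s) s) :
    ∃ n : ℕ, ∀ k : ℕ, n ≤ k → ∃ g : Polynomial ℝ, ∀ σ : ℝ, B.eval σ ≠ 0 →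
      HasDerivAt (fun t => g.eval t / (B ^ k).eval t) (M.eval σ / B.eval σ) σ := by
  obtain ⟨p, q, hq, he⟩ := hI
  have hS : (Ioo a b).Infinite := Ioo_infinite hab
  have hd' : ∀ s ∈ Ioo a b, HasDerivAt (fun t => p.eval t / q.eval t) (M.eval s / B.eval s) s :=
    fun s hs => (hd s hs).congr_of_eventuallyEq
      (Filter.eventuallyEq_of_mem (Ioo_mem_nhds hs.1 hs.2) he).symm
  obtain ⟨s₀, hs₀⟩ := hS.nonempty
  have hq0 : q ≠ 0 := fun h0 => hq s₀ hs₀ (by simp [h0])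
  obtain ⟨g, n, hg⟩ := exists_mul_eq_mul_pow hq0 (poly_eq_of_hasDerivAt hS p q M B hq hB hd')
  refine ⟨n, fun k hk => ⟨g * B ^ (k - n), fun σ hσ => ?_⟩⟩
  have hBk : ∀ t, B.eval t ≠ 0 → (B ^ k).eval t ≠ 0 := fun t h => by simpa using pow_ne_zero k h
  have he2 : (Ioo a b).EqOn (fun t => p.eval t / q.eval t)
      fun t => (g * B ^ (k - n)).eval t / (B ^ k).eval t := by
    intro s hs
    have h1 := congrArg (Polynomial.eval s) hg
    simp only [Polynomial.eval_mul, Polynomial.eval_pow] at h1 ⊢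
    rw [div_eq_div_iff (hq s hs) (pow_ne_zero k (hB s hs)), ← Nat.add_sub_cancel' hk, pow_add,
      Nat.add_sub_cancel_left]
    linear_combination -B.eval s ^ (k - n) * h1
  have hd2 : ∀ s ∈ Ioo a b, HasDerivAt (fun t => (g * B ^ (k - n)).eval t / (B ^ k).eval t)
      (M.eval s / B.eval s) s := fun s hs =>
    (hd' s hs).congr_of_eventuallyEq (Filter.eventuallyEq_of_mem (Ioo_mem_nhds hs.1 hs.2) he2).symm
  have hid := poly_eq_of_hasDerivAt hS _ _ M B (fun s hs => hBk s (hB s hs)) hB hd2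
  convert hasDerivAt_div (g * B ^ (k - n)) (B ^ k) (hBk σ hσ) using 1
  rw [div_eq_div_iff hσ (by simpa using pow_ne_zero 2 (hBk σ hσ))]
  have h3 := congrArg (Polynomial.eval σ) hid
  simp only [Polynomial.eval_mul] at h3
  linear_combination -h3

/-- RATIONAL on `(a, b)` is stable under `d/ds` (quotient rule, uniqueness of derivatives).
[folklore] -/
theorem rat_deriv {a b : ℝ} {F F' : ℝ → ℝ} (hd : ∀ s ∈ Ioo a b, HasDerivAt F (F' s) s)
    (hF : ∃ p q : Polynomial ℝ, (∀ s ∈ Ioo a b, q.eval s ≠ 0) ∧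
      (Ioo a b).EqOn F fun s => p.eval s / q.eval s) :
    ∃ p q : Polynomial ℝ, (∀ s ∈ Ioo a b, q.eval s ≠ 0) ∧
      (Ioo a b).EqOn F' fun s => p.eval s / q.eval s := by
  obtain ⟨p, q, hq, he⟩ := hF
  refine ⟨p.derivative * q - p * q.derivative, q ^ 2, fun s hs => by
    simpa using pow_ne_zero 2 (hq s hs), fun s hs => ?_⟩
  exact (hd s hs).unique ((hasDerivAt_div p q (hq s hs)).congr_of_eventuallyEq
    (Filter.eventuallyEq_of_mem (Ioo_mem_nhds hs.1 hs.2) he))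

/-- `F ↦ (F − A/Z)/Y` preserves RATIONAL on `(a, b)` (`A, Z, Y ∈ ℝ[X]`, `Z, Y ≠ 0` there).
[folklore] -/
theorem rat_sub_div {a b : ℝ} {F : ℝ → ℝ} (A Z Y : Polynomial ℝ)
    (hZ : ∀ s ∈ Ioo a b, Z.eval s ≠ 0) (hY : ∀ s ∈ Ioo a b, Y.eval s ≠ 0)
    (hF : ∃ p q : Polynomial ℝ, (∀ s ∈ Ioo a b, q.eval s ≠ 0) ∧
      (Ioo a b).EqOn F fun s => p.eval s / q.eval s) :
    ∃ p q : Polynomial ℝ, (∀ s ∈ Ioo a b, q.eval s ≠ 0) ∧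
      (Ioo a b).EqOn (fun s => (F s - A.eval s / Z.eval s) / Y.eval s)
        fun s => p.eval s / q.eval s := by
  obtain ⟨p, q, hq, he⟩ := hF
  refine ⟨p * Z - A * q, q * Z * Y, fun s hs => ?_, fun s hs => ?_⟩
  · simpa [Polynomial.eval_mul] using mul_ne_zero (mul_ne_zero (hq s hs) (hZ s hs)) (hY s hs)
  · simp only [he hs, Polynomial.eval_mul, Polynomial.eval_sub]
    field_simp [hq s hs, hZ s hs, hY s hs]

/-- `(F, G) ↦ A·F + G` (`A ∈ ℝ[X]`) preserves RATIONAL on `(a, b)`. [folklore] -/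
theorem rat_add {a b : ℝ} (A : Polynomial ℝ) {F G : ℝ → ℝ}
    (hF : ∃ p q : Polynomial ℝ, (∀ s ∈ Ioo a b, q.eval s ≠ 0) ∧
      (Ioo a b).EqOn F fun s => p.eval s / q.eval s)
    (hG : ∃ p q : Polynomial ℝ, (∀ s ∈ Ioo a b, q.eval s ≠ 0) ∧
      (Ioo a b).EqOn G fun s => p.eval s / q.eval s) :
    ∃ p q : Polynomial ℝ, (∀ s ∈ Ioo a b, q.eval s ≠ 0) ∧
      (Ioo a b).EqOn (fun s => A.eval s * F s + G s) fun s => p.eval s / q.eval s := by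
  obtain ⟨p, q, hq, he⟩ := hF
  obtain ⟨p', q', hq', he'⟩ := hG
  refine ⟨A * p * q' + p' * q, q * q', fun s hs => by
    simpa [Polynomial.eval_mul] using mul_ne_zero (hq s hs) (hq' s hs), fun s hs => ?_⟩
  simp only [he hs, he' hs, Polynomial.eval_mul, Polynomial.eval_add]
  field_simp [hq s hs, hq' s hs]

/-- Finite sums with polynomial weights preserve RATIONAL on `(a, b)`. [folklore] -/
theorem rat_sum {a b : ℝ} (T : Finset ℕ) (A : ℕ → Polynomial ℝ) (F : ℕ → ℝ → ℝ)
    (hF : ∀ i ∈ T, ∃ p q : Polynomial ℝ, (∀ s ∈ Ioo a b, q.eval s ≠ 0) ∧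
      (Ioo a b).EqOn (F i) fun s => p.eval s / q.eval s) :
    ∃ p q : Polynomial ℝ, (∀ s ∈ Ioo a b, q.eval s ≠ 0) ∧
      (Ioo a b).EqOn (fun s => ∑ i ∈ T, (A i).eval s * F i s) fun s => p.eval s / q.eval s := by
  induction T using Finset.induction_on with
  | empty => exact ⟨0, 1, fun s _ => by simp, fun s _ => by simp⟩
  | insert i T hi ih =>
    obtain ⟨p, q, hq, he⟩ := rat_add (A i) (hF i (Finset.mem_insert_self i T))
      (ih fun j hj => hF j (Finset.mem_insert_of_mem hj))
    refine ⟨p, q, hq, fun s hs => ?_⟩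
    beta_reduce
    rw [Finset.sum_insert hi]
    exact he hs

/-- **Triangular elimination.** Let `W, Vd ∈ ℝ[X]`, `W', Vd ≠ 0` on `(a, b)`, and let `I_0, …, I_D`
have derivatives `I_l' = M_l/Vd` on `(a, b)` (`M_l ∈ ℝ[X]`). If `Σ_{l ≤ D} W(s)ˡ·I_l(s)` is RATIONAL
on `(a, b)`, then so is every `I_l`: differentiate, divide by `W'` and induct on `D` (the derivative
of `Σ_{l ≤ D+1} Wˡ I_l` is `W'·Σ_{l ≤ D} Wˡ·(l+1)I_{l+1} + Σ_l Wˡ M_l/Vd`). [folklore] -/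
theorem elim {a b : ℝ} (W Vd : Polynomial ℝ) (hW : ∀ s ∈ Ioo a b, W.derivative.eval s ≠ 0)
    (hVd : ∀ s ∈ Ioo a b, Vd.eval s ≠ 0) (D : ℕ) :
    ∀ (I : ℕ → ℝ → ℝ) (M : ℕ → Polynomial ℝ),
      (∀ l ∈ Finset.range (D + 1), ∀ s ∈ Ioo a b,
        HasDerivAt (I l) ((M l).eval s / Vd.eval s) s) →
      (∃ p q : Polynomial ℝ, (∀ s ∈ Ioo a b, q.eval s ≠ 0) ∧
        (Ioo a b).EqOn (fun s => ∑ l ∈ Finset.range (D + 1), W.eval s ^ l * I l s)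
          fun s => p.eval s / q.eval s) →
      ∀ l ∈ Finset.range (D + 1), ∃ p q : Polynomial ℝ, (∀ s ∈ Ioo a b, q.eval s ≠ 0) ∧
        (Ioo a b).EqOn (I l) fun s => p.eval s / q.eval s := by
  induction D with
  | zero =>
    intro I M _ ⟨p, q, hq, he⟩ l hl
    obtain rfl : l = 0 := by simpa using hl
    exact ⟨p, q, hq, fun s hs => by simpa using he hs⟩
  | succ D ih =>
    intro I M hI hs
    have hd : ∀ s ∈ Ioo a b,
        HasDerivAt (fun s => ∑ l ∈ Finset.range (D + 1 + 1), W.eval s ^ l * I l s)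
          (∑ l ∈ Finset.range (D + 1 + 1), ((l : ℝ) * W.eval s ^ (l - 1) * W.derivative.eval s *
            I l s + W.eval s ^ l * ((M l).eval s / Vd.eval s))) s := fun s hs =>
      HasDerivAt.fun_sum fun l hl => ((W.hasDerivAt s).fun_pow l).fun_mul (hI l hl s hs)
    have h1 := rat_sub_div (∑ l ∈ Finset.range (D + 1 + 1), W ^ l * M l) Vd W.derivative hVd hW
      (rat_deriv hd hs)
    have h2 : ∃ p q : Polynomial ℝ, (∀ s ∈ Ioo a b, q.eval s ≠ 0) ∧
        (Ioo a b).EqOn (fun s => ∑ l ∈ Finset.range (D + 1),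
          W.eval s ^ l * ((l + 1 : ℝ) * I (l + 1) s)) fun s => p.eval s / q.eval s := by
      obtain ⟨p, q, hq, he⟩ := h1
      refine ⟨p, q, hq, fun s hs => ?_⟩
      rw [← he hs, eq_div_iff (hW s hs), Finset.sum_add_distrib, Polynomial.eval_finsetSum,
        Finset.sum_div, add_sub_assoc, ← Finset.sum_sub_distrib, Finset.sum_range_succ' _ (D + 1),
        Finset.sum_mul]
      simp only [Polynomial.eval_mul, Polynomial.eval_pow, mul_div_assoc, sub_self,
        Finset.sum_const_zero, add_zero, Nat.cast_zero, zero_mul, Nat.cast_succ, Nat.add_sub_cancel]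
      exact Finset.sum_congr rfl fun l _ => by ring
    have h3 := ih (fun l s => (l + 1 : ℝ) * I (l + 1) s)
      (fun l => Polynomial.C ((l : ℝ) + 1) * M (l + 1)) (fun l hl s hs => by
        simpa [mul_div_assoc] using
          (hI (l + 1) (by simpa using hl) s hs).const_mul ((l : ℝ) + 1)) h2
    have h4 : ∀ l ∈ Finset.range (D + 1), ∃ p q : Polynomial ℝ, (∀ s ∈ Ioo a b, q.eval s ≠ 0) ∧
        (Ioo a b).EqOn (I (l + 1)) fun s => p.eval s / q.eval s := fun l hl => by
      obtain ⟨p, q, hq, he⟩ := rat_sum {l} (fun _ => Polynomial.C ((l : ℝ) + 1)⁻¹) _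
        fun j hj => h3 j (by rwa [Finset.mem_singleton.1 hj])
      refine ⟨p, q, hq, fun s hs => ?_⟩
      rw [← he hs]
      simp [inv_mul_cancel_left₀ (Nat.cast_add_one_ne_zero (R := ℝ) l)]
    intro l hl
    rcases l with _ | l
    · obtain ⟨p, q, hq, he⟩ := rat_add 1 hs (rat_sum (Finset.range (D + 1))
        (fun l => -W ^ (l + 1)) (fun l => I (l + 1)) h4)
      refine ⟨p, q, hq, fun s hs => ?_⟩
      rw [← he hs]
      simp [Finset.sum_range_succ' _ (D + 1)]
    · exact h4 l (by simpa using hl)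

/-- **Polynomial-in-`y` structure of the integrand**: there are `Q ∈ ℝ[X][Y]` and `c ∈ ℕ` with
`P((y − u(σ))/v(σ), σ) = Q(σ)(y)/v(σ)^c` whenever `v(σ) ≠ 0` (induction on `P`). [folklore] -/
theorem exists_decomp (u v : Polynomial ℚ) (P : MvPolynomial (Fin 2) ℚ) :
    ∃ (Q : Polynomial (Polynomial ℝ)) (c : ℕ), ∀ y σ : ℝ, Polynomial.aeval σ v ≠ 0 →
      aeval (![(y - Polynomial.aeval σ u) / Polynomial.aeval σ v, σ] : Fin 2 → ℝ) P =
        (Q.eval (Polynomial.C y)).eval σ / Polynomial.aeval σ v ^ c := by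
  induction P using MvPolynomial.induction_on with
  | C a => exact ⟨Polynomial.C (Polynomial.C (a : ℝ)), 0, fun y σ _ => by simp⟩
  | add p q hp hq =>
    obtain ⟨Q₁, c₁, h₁⟩ := hp
    obtain ⟨Q₂, c₂, h₂⟩ := hq
    refine ⟨Q₁ * Polynomial.C (v.map (algebraMap ℚ ℝ) ^ c₂) +
      Q₂ * Polynomial.C (v.map (algebraMap ℚ ℝ) ^ c₁), c₁ + c₂, fun y σ hv => ?_⟩
    rw [map_add, h₁ y σ hv, h₂ y σ hv]
    simp only [Polynomial.eval_add, Polynomial.eval_mul, Polynomial.eval_C, Polynomial.eval_pow,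
      Polynomial.eval_map_algebraMap]
    field_simp
    ring
  | mul_X p i hp =>
    obtain ⟨Q, c, h⟩ := hp
    fin_cases i
    · refine ⟨Q * (Polynomial.X - Polynomial.C (u.map (algebraMap ℚ ℝ))), c + 1, fun y σ hv => ?_⟩
      rw [map_mul, h y σ hv]
      simp only [Fin.zero_eta, aeval_X, Matrix.cons_val_zero, Polynomial.eval_mul,
        Polynomial.eval_sub, Polynomial.eval_X, Polynomial.eval_C, Polynomial.eval_map_algebraMap]
      field_simp
      ring
    · refine ⟨Q * Polynomial.C Polynomial.X, c, fun y σ hv => ?_⟩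
      rw [map_mul, h y σ hv]
      simp only [Fin.mk_one, aeval_X, Matrix.cons_val_one, Matrix.cons_val_fin_one,
        Polynomial.eval_mul, Polynomial.eval_C, Polynomial.eval_X]
      ring

end GwRationalPrimitive

open GwRationalPrimitive in
/-- **Graph pencil with a polynomial slope: the single-branch integrand has a rational primitive**
(stub `stub_gwRationalPrimitive` of the crux `TateFamilyKernel`, line `Sketch`). With
`f(y, σ) = P((y − u(σ))/v(σ), σ)/v(σ) = Σ_l yˡ φ_l(σ)` and `I_l(s) = ∫_{(s,1)} φ_l`, the vanishing
`Σ_l W(s)ˡ I_l(s) = 0` on `(s₁, 1)` (`W = u + v`, `W' > 0` there) makes every `I_l` rational on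
`(s₁, 1)` (`GwRationalPrimitive.elim`) with denominator a power of `v`
(`GwRationalPrimitive.exists_primitive`); `Rn/v^k := −Σ_l yˡ I_l` then has `σ`-derivative
`f(y, σ)` wherever `v ≠ 0`, in particular on `[0, 1]`. [cite: KontsevichZagier2001, §1.2] -/
theorem stub_gwRationalPrimitive (u v : Polynomial ℚ) (P : MvPolynomial (Fin 2) ℚ) (s₁ : ℝ) (hs₁0 : 0 ≤ s₁) (hs₁ : s₁ < 1)
    (hv : ∀ σ ∈ Icc (0 : ℝ) 1, Polynomial.aeval σ v ≠ 0)
    (hWpos : ∀ s ∈ Ioo s₁ 1, 0 < Polynomial.aeval s (Polynomial.derivative (u + v)))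
    (hzero : ∀ s ∈ Ioo s₁ 1,
      ∫ σ in Ioo s 1, aeval (![(Polynomial.aeval s u + Polynomial.aeval s v - Polynomial.aeval σ u) /
          Polynomial.aeval σ v, σ] : Fin 2 → ℝ) P / Polynomial.aeval σ v = 0) :
    ∃ (Rn : MvPolynomial (Fin 2) ℝ) (k : ℕ), ∀ y σ : ℝ, σ ∈ Icc (0 : ℝ) 1 →
      HasDerivAt (fun t : ℝ => MvPolynomial.eval (![y, t] : Fin 2 → ℝ) Rn / (Polynomial.aeval t v) ^ k)
        (aeval (![(y - Polynomial.aeval σ u) / Polynomial.aeval σ v, σ] : Fin 2 → ℝ) P / Polynomial.aeval σ v) σ := by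
  -- the real polynomials `V = v`, `W = u + v`; the decomposition `f = Σ_l yˡ φ_l`
  obtain ⟨V, hV⟩ : ∃ V : Polynomial ℝ, V = v.map (algebraMap ℚ ℝ) := ⟨_, rfl⟩
  obtain ⟨W, hW⟩ : ∃ W : Polynomial ℝ, W = (u + v).map (algebraMap ℚ ℝ) := ⟨_, rfl⟩
  have hVe : ∀ σ, V.eval σ = Polynomial.aeval σ v := fun σ => by
    rw [hV, Polynomial.eval_map_algebraMap]
  have hWe : ∀ s, W.eval s = Polynomial.aeval s u + Polynomial.aeval s v := fun s => by simp [hW]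
  have hWd : ∀ s ∈ Ioo s₁ 1, W.derivative.eval s ≠ 0 := fun s hs => by
    rw [hW, Polynomial.derivative_map, Polynomial.eval_map_algebraMap]
    exact (hWpos s hs).ne'
  obtain ⟨Q, c, hQ⟩ := exists_decomp u v P
  obtain ⟨φ, hφ⟩ : ∃ φ : ℕ → ℝ → ℝ, φ = fun l σ => (Q.coeff l).eval σ / (V ^ (c + 1)).eval σ :=
    ⟨_, rfl⟩
  obtain ⟨I, hI⟩ : ∃ I : ℕ → ℝ → ℝ, I = fun l s => ∫ σ in Ioo s 1, φ l σ := ⟨_, rfl⟩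
  have hV1 : ∀ σ ∈ Icc s₁ 1, V.eval σ ≠ 0 := fun σ hσ => hVe σ ▸ hv σ ⟨hs₁0.trans hσ.1, hσ.2⟩
  have hVp : ∀ σ, V.eval σ ≠ 0 → (V ^ (c + 1)).eval σ ≠ 0 := fun σ hσ => by
    simpa only [Polynomial.eval_pow] using pow_ne_zero _ hσ
  have hexp : ∀ y σ, V.eval σ ≠ 0 →
      aeval (![(y - Polynomial.aeval σ u) / Polynomial.aeval σ v, σ] : Fin 2 → ℝ) P /
        Polynomial.aeval σ v = ∑ l ∈ Finset.range (Q.natDegree + 1), y ^ l * φ l σ := by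
    intro y σ hσ
    rw [hQ y σ (by rwa [← hVe]), Polynomial.eval_eq_sum_range (p := Q), Polynomial.eval_finsetSum,
      Finset.sum_div, Finset.sum_div]
    refine Finset.sum_congr rfl fun l _ => ?_
    simp only [hφ, Polynomial.eval_mul, Polynomial.eval_pow, Polynomial.eval_C, hVe]
    ring
  have hφc : ∀ l, ∀ σ ∈ Icc s₁ 1, ContinuousAt (φ l) σ := fun l σ hσ => hφ ▸
    (Q.coeff l).continuous.continuousAt.div (V ^ (c + 1)).continuous.continuousAt (hVp σ (hV1 σ hσ))
  -- FTC: `I_l' = −φ_l` on `(s₁, 1)`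
  have hId : ∀ l, ∀ s ∈ Ioo s₁ 1,
      HasDerivAt (I l) ((-Q.coeff l).eval s / (V ^ (c + 1)).eval s) s := fun l s hs => by
    simpa [hφ, neg_div] using (GvDivision.hasDerivAt_of_integral_eq (φ l) (fun s => -I l s) 0 s₁
      s hs (hφc l) fun s' _ => by simp [hI]).fun_neg
  -- the hypothesis: `Σ_l W(s)ˡ I_l(s) = 0` on `(s₁, 1)`
  have hsum : ∃ p q : Polynomial ℝ, (∀ s ∈ Ioo s₁ 1, q.eval s ≠ 0) ∧ (Ioo s₁ 1).EqOn
      (fun s => ∑ l ∈ Finset.range (Q.natDegree + 1), W.eval s ^ l * I l s)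
      fun s => p.eval s / q.eval s := by
    refine ⟨0, 1, fun s _ => by simp, fun s hs => ?_⟩
    have hint : ∀ l, IntegrableOn (φ l) (Ioo s 1) := fun l =>
      (ContinuousOn.integrableOn_Icc fun σ hσ =>
        (hφc l σ ⟨hs.1.le.trans hσ.1, hσ.2⟩).continuousWithinAt).mono_set Ioo_subset_Icc_self
    have h0 := hzero s hs
    rw [setIntegral_congr_fun measurableSet_Ioo fun σ hσ =>
      hexp _ σ (hV1 σ ⟨hs.1.le.trans hσ.1.le, hσ.2.le⟩), integral_finsetSum _ fun l _ =>
      (hint l).const_mul _] at h0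
    simpa [integral_const_mul, hWe, hI] using h0
  -- elimination and cancellation
  have hrat := elim W (V ^ (c + 1)) hWd (fun s hs => hVp s (hV1 s (Ioo_subset_Icc_self hs)))
    Q.natDegree I (fun l => -Q.coeff l) (fun l _ => hId l) hsum
  have hprim : ∀ l ∈ Finset.range (Q.natDegree + 1), ∃ n : ℕ, ∀ k : ℕ, n ≤ k →
      ∃ g : Polynomial ℝ, ∀ σ : ℝ, (V ^ (c + 1)).eval σ ≠ 0 →
        HasDerivAt (fun t => g.eval t / ((V ^ (c + 1)) ^ k).eval t)
          ((-Q.coeff l).eval σ / (V ^ (c + 1)).eval σ) σ := fun l hl =>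
    exists_primitive hs₁ _ _ (I l) (fun s hs => hVp s (hV1 s (Ioo_subset_Icc_self hs)))
      (hrat l hl) (hId l)
  choose! n hn using hprim
  have hg := fun l hl => hn l hl ((Finset.range (Q.natDegree + 1)).sup n) (Finset.le_sup hl)
  choose! g hg using hg
  -- the primitive `Rn/v^k`, `Rn = −Σ_l (X 0)ˡ g_l(X 1)`, `k = (c+1)·sup n`
  refine ⟨-∑ l ∈ Finset.range (Q.natDegree + 1), X 0 ^ l * (g l).toMvPolynomial 1,
    (c + 1) * (Finset.range (Q.natDegree + 1)).sup n, fun y σ hσ => ?_⟩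
  have hσ' : V.eval σ ≠ 0 := by rw [hVe]; exact hv σ hσ
  have h := (HasDerivAt.fun_sum fun l hl => (hg l hl σ (hVp σ hσ')).const_mul (y ^ l)).fun_neg
  refine (h.congr_deriv ?_).congr_of_eventuallyEq (Filter.Eventually.of_forall fun t => ?_)
  · rw [hexp y σ hσ']
    simp only [hφ, Polynomial.eval_neg, neg_div, mul_neg, Finset.sum_neg_distrib, neg_neg]
  · simp only [map_neg, map_sum, map_mul, map_pow, MvPolynomial.eval_X, Matrix.cons_val_zero,
      MvPolynomial.eval_toMvPolynomial, Matrix.cons_val_one, Matrix.cons_val_fin_one,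
      Polynomial.eval_pow, hVe, ← pow_mul, neg_div, Finset.sum_div, mul_div_assoc]

end Summit.KontsevichZagierPeriods.InverseLandau.TateFamilyKernel.Descent
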